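import Mathlib
import HarnessLib
import Summits.AnomalousDissipation.AnomalousDissipation.Theses.TameRoughRigidity
import Summits.AnomalousDissipation.AnomalousDissipation.Theorems.TameRoughRigidityGPOrientationBridgeTools

/-!
# `TameRoughRigidity.GPOrientationBridge` (stmt-AnomalousDissipation-18404): stationary
# statistical solutions push forward along the axis swap, and `CyclicForceCoercive ↔ GPEulerCoercive`

The route decl (support, rank 9 of route `TameRoughRigidity`):
```
def GPOrientationBridge : Prop :=
  (∀ μ, ¬ Torus.IsStationaryStatisticalSolution 0 (frameField (single 1 1) 0 false +
      frameField (single 2 1) 1 false + frameField (single 0 1) 2 false) μ) ↔ GPEulerCoercive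
```
i.e. FSS's cyclic force `f₁ = sin(2πx₁)e₀ + sin(2πx₂)e₁ + sin(2πx₀)e₂` carries no stationary
statistical solution of the forced Euler equations (FMRT class) iff `f_GP` carries none.

**Proof.** Let `σ = Equiv.swap (1 : Fin 3) 2`, `P x = x ∘ σ` on `T³` (written `fun i => x (σ i)`),
`A = LinearIsometryEquiv.piLpCongrLeft 2 ℝ ℝ σ` on `ℝ³`; the torus-level toolkit for the conjugation
`w ↦ A ∘ w ∘ P` is `TameRoughRigidityGPOrientationBridgeTools.lean`. This file works with an
*arbitrary* continuous linear operator `T` of the energy space `H` whose values represent the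
conjugation, `(T u)(x) = A (u (P x))` for a.e. `x` (hypothesis `hT`; no object is defined): such a
`T` is automatically an involutive isometry of `H` (`th_th`, `enorm_th`), hence a measurable
embedding, so push-forward integrals along `T` are computed by substitution
(`MeasurableEmbedding.lintegral_map / integrable_map_iff / integral_map / setIntegral_map`, as in
the accepted `TaylorCertificatesEnsembleCeilingStubScalingCovariance.lean`). Field by field of
`Torus.IsStationaryStatisticalSolution ν f μ` (FMRT Ch. IV Def. 1.3), for **every** `ν`:
(1.29) `‖∇(T u)‖² = ‖∇u‖²` (spectral enstrophy, Fourier reindexing `k ↦ k ∘ σ`); (1.30) for a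
cylindrical `Φ` (fields `gᵢ`, profile `φ`) the swapped functional `Φ_T` (fields `A ∘ gᵢ ∘ P`, same
profile) sees at `u` the coordinates `Φ` sees at `T u` (`(T u, g) = (u, A g P)`), so
`Φ'(T u) = A ∘ Φ_T'(u) ∘ P` and term by term `⟨F_{ν, AfP}(T u), A w P⟩ = ⟨F_{ν, f}(u), w⟩` (force:
isometry + change of variables; Stokes: `Δ(AwP) = A (Δw) P`; inertial: the unconditional chain
rule `D(AwP)(x) = A Dw(Px) A`); (1.31) energy shells are `T`-invariant (`‖T u‖ = ‖u‖`) and the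
integrand `ν‖∇u‖² − (u, f)` is invariant. Hence `IsSSS ν f μ → IsSSS ν (A ∘ f ∘ P) (map T μ)`
(`isStationaryStatisticalSolution_map`). Such a `T` EXISTS (`exists_operator`): on `L²(T³; ℝ³)`
take `S = compLpL A ∘ Lp.compMeasurePreserving P` (values a.e. `A ∘ u ∘ P`); `S` maps `𝒱` (smooth
solenoidal mean-zero classes) into itself, hence `H = closure (span 𝒱)` into itself, and `T` is
its co-restriction. The conjugation being an involution on forces, the no-SSS classes of `f` and
`A ∘ f ∘ P` coincide (`forall_not_isSSS_iff_conj`), and `A ∘ f_GP ∘ P = f₁`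
(`OrientationBridge.conj_gpForce`) closes the decl (`gpOrientationBridge_proof`).
Pure proof file: no definitions, no notation.

References: C. Foias, O. Manley, R. Rosa, R. Temam, *Navier–Stokes Equations and Turbulence*
(CUP 2001), Ch. IV §1.2, Def. 1.3, (1.29)–(1.31). The symmetry itself is folklore.
-/

-- `Summit.<Summit>.<Problem>` is the tree's mandated summit-side namespace (CONVENTIONS §2); for
-- this single-conjunct summit the two coincide, so the duplicate is deliberate.
set_option linter.dupNamespace false

noncomputable section

open MeasureTheory Filter Topology Set UnitAddTorus
open scoped InnerProductSpace ENNReal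
open Literature.Analysis.FunctionSpaces Literature.Analysis.FunctionSpaces.Torus
open Literature.Analysis.FluidPDE Literature.Analysis.FluidPDE.Torus
open LinearIsometryEquiv (piLpCongrLeft)
open Equiv (swap)

namespace Summit.AnomalousDissipation.AnomalousDissipation.Theorems.TameRoughRigidity

namespace OrientationBridge

/-! ## `L²` classes conjugate to each other -/

/-- Through the involution: if `v = A u P` and `u = A z P` a.e., then `v = z` a.e. [folklore] -/
theorem ae_eq_of_ae_conj_conj {v u z : UnitAddTorus (Fin 3) → EuclideanSpace ℝ (Fin 3)}
    (h1 : ∀ᵐ x ∂volume, v x = piLpCongrLeft 2 ℝ ℝ (swap 1 2) (u (fun i => x (swap 1 2 i))))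
    (h2 : ∀ᵐ x ∂volume, u x = piLpCongrLeft 2 ℝ ℝ (swap 1 2) (z (fun i => x (swap 1 2 i)))) :
    v =ᵐ[volume] z := by
  filter_upwards [h1, comp_swap_ae_eq h2] with x hx1 hx2
  rw [hx1, hx2]
  simp only [Equiv.swap_apply_self, a_a]

/-- An `L²` class a.e. equal to `A u P` has the norm of `u` (`A` is an isometry, `P` is measure
preserving). [folklore] -/
theorem norm_eq_of_ae_conj {v u : Lp (EuclideanSpace ℝ (Fin 3)) 2 (volume : Measure (UnitAddTorus (Fin 3)))}
    (h : ∀ᵐ x ∂volume, v x = piLpCongrLeft 2 ℝ ℝ (swap 1 2) (u (fun i => x (swap 1 2 i)))) :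
    ‖v‖ = ‖u‖ := by
  rw [Lp.norm_def, Lp.norm_def, eLpNorm_congr_ae h]
  congr 1
  have h' : eLpNorm (fun x : UnitAddTorus (Fin 3) =>
        piLpCongrLeft 2 ℝ ℝ (swap 1 2) (u (fun i => x (swap 1 2 i)))) 2 volume =
      eLpNorm (fun x : UnitAddTorus (Fin 3) => u (fun i => x (swap 1 2 i))) 2 volume :=
    eLpNorm_congr_norm_ae (ae_of_all _ fun x => by simp only [LinearIsometryEquiv.norm_map])
  rw [h']
  exact eLpNorm_comp_measurePreserving (Lp.aestronglyMeasurable u) measurePreserving_swap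

/-- Pairings transform by duality: `(v, g) = (u, A g P)` when `v = A u P` a.e. (no integrability
needed). [folklore] -/
theorem pairing_of_ae_conj {v u : Lp (EuclideanSpace ℝ (Fin 3)) 2 (volume : Measure (UnitAddTorus (Fin 3)))}
    (h : ∀ᵐ x ∂volume, v x = piLpCongrLeft 2 ℝ ℝ (swap 1 2) (u (fun i => x (swap 1 2 i))))
    (g : UnitAddTorus (Fin 3) → EuclideanSpace ℝ (Fin 3)) :
    pairing v g = pairing u (fun x => piLpCongrLeft 2 ℝ ℝ (swap 1 2) (g (fun i => x (swap 1 2 i)))) := by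
  unfold pairing
  rw [← integral_comp_swap (fun y : UnitAddTorus (Fin 3) =>
    ⟪u y, piLpCongrLeft 2 ℝ ℝ (swap 1 2) (g (fun i => y (swap 1 2 i)))⟫_ℝ)]
  refine integral_congr_ae ?_
  filter_upwards [h] with x hx
  rw [hx, inner_a_left]
  simp only [Equiv.swap_apply_self]

/-- The inertial pairing is invariant, `∫ (v ⊗ v) : ∇(A w P) = ∫ (u ⊗ u) : ∇w` when `v = A u P` a.e.
(no differentiability or integrability needed). [folklore] -/
theorem inertialPairing_of_ae_conj
    {v u : Lp (EuclideanSpace ℝ (Fin 3)) 2 (volume : Measure (UnitAddTorus (Fin 3)))}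
    (h : ∀ᵐ x ∂volume, v x = piLpCongrLeft 2 ℝ ℝ (swap 1 2) (u (fun i => x (swap 1 2 i))))
    (w : UnitAddTorus (Fin 3) → EuclideanSpace ℝ (Fin 3)) :
    inertialPairing v (fun x => piLpCongrLeft 2 ℝ ℝ (swap 1 2) (w (fun i => x (swap 1 2 i)))) =
      inertialPairing u w := by
  unfold inertialPairing
  rw [← integral_comp_swap (fun y : UnitAddTorus (Fin 3) => ⟪Torus.fderiv w y (u y), u y⟫_ℝ)]
  refine integral_congr_ae ?_
  filter_upwards [h] with x hx
  rw [hx, inner_fderiv_conj]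

/-- The Stokes pairing is invariant, `∫ ⟪v, Δ(A w P)⟫ = ∫ ⟪u, Δw⟫` when `v = A u P` a.e. and `w` is
smooth. [folklore] -/
theorem integral_inner_laplacian_of_ae_conj
    {v u : Lp (EuclideanSpace ℝ (Fin 3)) 2 (volume : Measure (UnitAddTorus (Fin 3)))}
    (h : ∀ᵐ x ∂volume, v x = piLpCongrLeft 2 ℝ ℝ (swap 1 2) (u (fun i => x (swap 1 2 i))))
    {w : UnitAddTorus (Fin 3) → EuclideanSpace ℝ (Fin 3)} (hw : IsSmooth w) :
    ∫ x, ⟪v x, Torus.laplacian (fun y : UnitAddTorus (Fin 3) =>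
        piLpCongrLeft 2 ℝ ℝ (swap 1 2) (w (fun i => y (swap 1 2 i)))) x⟫_ℝ =
      ∫ x, ⟪u x, Torus.laplacian w x⟫_ℝ := by
  rw [← integral_comp_swap (fun y : UnitAddTorus (Fin 3) => ⟪u y, Torus.laplacian w y⟫_ℝ)]
  refine integral_congr_ae ?_
  filter_upwards [h] with x hx
  rw [hx, laplacian_conj hw, LinearIsometryEquiv.inner_map_map]

/-- The spectral enstrophy only sees the conjugation class: `‖∇v‖² = ‖∇u‖²` when `v = A u P` a.e.
[folklore] -/
theorem eGradNormSq_of_ae_conj {v u : UnitAddTorus (Fin 3) → EuclideanSpace ℝ (Fin 3)}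
    (h : ∀ᵐ x ∂volume, v x = piLpCongrLeft 2 ℝ ℝ (swap 1 2) (u (fun i => x (swap 1 2 i)))) :
    eGradNormSq v = eGradNormSq u := by
  rw [← eGradNormSq_conj u]
  unfold eGradNormSq eHomSobolevSeminorm
  simp_rw [Torus.mFourierCoeff_congr_ae (show (EuclideanSpace.complexify ∘ v) =ᵐ[volume]
    (EuclideanSpace.complexify ∘ fun x : UnitAddTorus (Fin 3) =>
      piLpCongrLeft 2 ℝ ℝ (swap 1 2) (u (fun i => x (swap 1 2 i))))
    from h.mono fun x hx => by simp only [Function.comp_apply, hx])]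

/-- `𝒱` (smooth, solenoidal, mean-zero classes) is stable: if `u ∈ 𝒱` and `v = A u P` a.e. then
`v ∈ 𝒱`. [folklore] -/
theorem mem_smoothSolenoidal_of_ae_conj
    {v u : Lp (EuclideanSpace ℝ (Fin 3)) 2 (volume : Measure (UnitAddTorus (Fin 3)))}
    (h : ∀ᵐ x ∂volume, v x = piLpCongrLeft 2 ℝ ℝ (swap 1 2) (u (fun i => x (swap 1 2 i))))
    (hu : u ∈ smoothSolenoidal (Fin 3)) : v ∈ smoothSolenoidal (Fin 3) := by
  obtain ⟨f, hf, hdiv, hmean, hae⟩ := hu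
  refine ⟨fun x => piLpCongrLeft 2 ℝ ℝ (swap 1 2) (f (fun i => x (swap 1 2 i))), isContDiff_conj hf,
    fun x => (divergence_conj f x).trans (hdiv _), hasZeroMean_conj hmean, ?_⟩
  filter_upwards [h, comp_swap_ae_eq hae] with x hx1 hx2
  rw [hx1]
  exact congrArg _ hx2

/-! ## An operator on `H` representing the conjugation exists -/

/-- On `L²(T³; ℝ³)` the conjugation is represented by the continuous linear operator
`compLpL A ∘ Lp.compMeasurePreserving P`. [folklore] -/
theorem exists_lpOperator :
    ∃ S : Lp (EuclideanSpace ℝ (Fin 3)) 2 (volume : Measure (UnitAddTorus (Fin 3))) →L[ℝ]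
        Lp (EuclideanSpace ℝ (Fin 3)) 2 (volume : Measure (UnitAddTorus (Fin 3))),
      ∀ u, ∀ᵐ x ∂volume, S u x = piLpCongrLeft 2 ℝ ℝ (swap 1 2) (u (fun i => x (swap 1 2 i))) := by
  refine ⟨(ContinuousLinearMap.compLpL 2 (volume : Measure (UnitAddTorus (Fin 3)))
      (piLpCongrLeft 2 ℝ ℝ (swap (1 : Fin 3) 2) :
        EuclideanSpace ℝ (Fin 3) →L[ℝ] EuclideanSpace ℝ (Fin 3))).comp
    (Lp.compMeasurePreservingₗᵢ ℝ (fun x : UnitAddTorus (Fin 3) => fun i => x (swap 1 2 i))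
      measurePreserving_swap).toContinuousLinearMap, fun u => ?_⟩
  have h2 : ∀ᵐ x ∂volume, (Lp.compMeasurePreservingₗᵢ ℝ
      (fun x : UnitAddTorus (Fin 3) => fun i => x (swap 1 2 i)) measurePreserving_swap
        (E := EuclideanSpace ℝ (Fin 3)) (p := 2)).toContinuousLinearMap u x =
      u (fun i => x (swap 1 2 i)) :=
    Lp.coeFn_compMeasurePreserving u measurePreserving_swap
  refine (ContinuousLinearMap.coeFn_compLpL _ _).trans ?_
  filter_upwards [h2] with x hx
  exact congrArg (piLpCongrLeft 2 ℝ ℝ (swap (1 : Fin 3) 2)) hx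

/-- An `L²` operator representing the conjugation maps the energy space `H` (the `L²` closure of
`span 𝒱`) into itself. [folklore] -/
theorem lpOperator_mem_energySpace
    {S : Lp (EuclideanSpace ℝ (Fin 3)) 2 (volume : Measure (UnitAddTorus (Fin 3))) →L[ℝ]
      Lp (EuclideanSpace ℝ (Fin 3)) 2 (volume : Measure (UnitAddTorus (Fin 3)))}
    (hS : ∀ u, ∀ᵐ x ∂volume, S u x = piLpCongrLeft 2 ℝ ℝ (swap 1 2) (u (fun i => x (swap 1 2 i))))
    {v : Lp (EuclideanSpace ℝ (Fin 3)) 2 (volume : Measure (UnitAddTorus (Fin 3)))}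
    (hv : v ∈ energySpace (Fin 3)) : S v ∈ energySpace (Fin 3) := by
  have hspan : MapsTo S ↑(Submodule.span ℝ (smoothSolenoidal (Fin 3)))
      ↑(Submodule.span ℝ (smoothSolenoidal (Fin 3))) := by
    intro w hw
    have h : S w ∈ (Submodule.span ℝ (smoothSolenoidal (Fin 3))).map S.toLinearMap :=
      Submodule.mem_map_of_mem hw
    rw [Submodule.map_span] at h
    refine Submodule.span_mono ?_ h
    rintro _ ⟨v, hv, rfl⟩
    exact mem_smoothSolenoidal_of_ae_conj (hS v) hv
  unfold energySpace at hv ⊢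
  rw [← SetLike.mem_coe, Submodule.topologicalClosure_coe] at hv ⊢
  exact map_mem_closure S.continuous hv hspan

/-- **Existence of the swap on `H`**: there is a continuous linear operator `T` of the energy space
whose values represent the conjugation, `(T u)(x) = A (u (P x))` for a.e. `x` (the co-restriction
of `exists_lpOperator`). [folklore] -/
theorem exists_operator :
    ∃ T : energySpace (Fin 3) →L[ℝ] energySpace (Fin 3), ∀ u : energySpace (Fin 3),
      ∀ᵐ x ∂volume, (T u).1 x = piLpCongrLeft 2 ℝ ℝ (swap 1 2) (u.1 (fun i => x (swap 1 2 i))) := by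
  obtain ⟨S, hS⟩ := exists_lpOperator
  exact ⟨(S.comp (energySpace (Fin 3)).subtypeL).codRestrict (energySpace (Fin 3))
    (fun u => lpOperator_mem_energySpace hS u.2), fun u => hS u.1⟩

/-! ## Covariance along any operator representing the conjugation -/

section Covariance

variable {T : energySpace (Fin 3) →L[ℝ] energySpace (Fin 3)}
  (hT : ∀ u : energySpace (Fin 3), ∀ᵐ x ∂volume,
    (T u).1 x = piLpCongrLeft 2 ℝ ℝ (swap 1 2) (u.1 (fun i => x (swap 1 2 i))))
include hT

/-- Such a `T` is an involution of `H`. [folklore] -/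
theorem th_th (u : energySpace (Fin 3)) : T (T u) = u :=
  Subtype.ext (Lp.ext (ae_eq_of_ae_conj_conj (hT (T u)) (hT u)))

/-- Such a `T` preserves the (extended) norm of `H`. [folklore] -/
theorem enorm_th (u : energySpace (Fin 3)) : ‖T u‖ₑ = ‖u‖ₑ := by
  rw [← ofReal_norm, ← ofReal_norm]
  congr 1
  exact norm_eq_of_ae_conj (hT u)

/-- Such a `T` is a measurable embedding of `H` (an involutive homeomorphism). [folklore] -/
theorem measurableEmbedding_th : MeasurableEmbedding T :=
  (ContinuousLinearEquiv.equivOfInverse T T (th_th hT) (th_th hT)).toHomeomorph.measurableEmbedding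

omit hT in
/-- `Φ'(u)` is smooth for every cylindrical test functional `Φ` (a constant-coefficient
combination of the smooth `gᵢ`). [folklore] -/
theorem isSmooth_grad (Φ : CylindricalTest (Fin 3)) (u : energySpace (Fin 3)) : IsSmooth (Φ.grad u) := by
  have h : lift (Φ.grad u) = fun y => ∑ i,
      (_root_.fderiv ℝ Φ.φ (Φ.coords u) (EuclideanSpace.single i 1)) • lift (Φ.g i) y := rfl
  unfold IsSmooth
  rw [h]
  exact ContDiff.sum fun i _ => (Φ.g_smooth i).const_smul _

/-- **Covariance of the Navier–Stokes generator**: `⟨F_{ν, AfP}(T u), A w P⟩ = ⟨F_{ν, f}(u), w⟩` for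
smooth `w` (force, Stokes and inertial pairings separately). [folklore] -/
theorem nsGeneratorPairing_th (ν : ℝ) (f : UnitAddTorus (Fin 3) → EuclideanSpace ℝ (Fin 3))
    (u : energySpace (Fin 3)) {w : UnitAddTorus (Fin 3) → EuclideanSpace ℝ (Fin 3)} (hw : IsSmooth w) :
    nsGeneratorPairing ν (fun x => piLpCongrLeft 2 ℝ ℝ (swap 1 2) (f (fun i => x (swap 1 2 i)))) (T u)
        (fun x => piLpCongrLeft 2 ℝ ℝ (swap 1 2) (w (fun i => x (swap 1 2 i)))) =
      nsGeneratorPairing ν f u w := by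
  unfold nsGeneratorPairing
  rw [inertialPairing_of_ae_conj (hT u), integral_inner_laplacian_of_ae_conj (hT u) hw]
  congr 2
  rw [← integral_comp_swap (fun y : UnitAddTorus (Fin 3) => ⟪f y, w y⟫_ℝ)]
  simp only [LinearIsometryEquiv.inner_map_map]

/-- The swapped test functional `Φ_T` (fields `A ∘ gᵢ ∘ P`, same profile) sees at `u` the
coordinates `Φ` sees at `T u`. [folklore] -/
theorem coords_th (Φ : CylindricalTest (Fin 3)) (u : energySpace (Fin 3)) :
    (⟨Φ.m, fun i x => piLpCongrLeft 2 ℝ ℝ (swap 1 2) (Φ.g i (fun k => x (swap 1 2 k))),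
        fun i => isContDiff_conj (Φ.g_smooth i),
        fun i x => (divergence_conj (Φ.g i) x).trans (Φ.g_divFree i _),
        fun i => hasZeroMean_conj (Φ.g_zeroMean i), Φ.φ, Φ.φ_contDiff, Φ.φ_compact⟩ :
        CylindricalTest (Fin 3)).coords u = Φ.coords (T u) := by
  unfold CylindricalTest.coords
  congr 1
  funext i
  exact (pairing_of_ae_conj (hT u) _).symm

/-- `Φ'(T u) = A ∘ Φ_T'(u) ∘ P`. [folklore] -/
theorem grad_th (Φ : CylindricalTest (Fin 3)) (u : energySpace (Fin 3)) :
    Φ.grad (T u) = fun x : UnitAddTorus (Fin 3) => piLpCongrLeft 2 ℝ ℝ (swap 1 2)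
      ((⟨Φ.m, fun i x => piLpCongrLeft 2 ℝ ℝ (swap 1 2) (Φ.g i (fun k => x (swap 1 2 k))),
        fun i => isContDiff_conj (Φ.g_smooth i),
        fun i x => (divergence_conj (Φ.g i) x).trans (Φ.g_divFree i _),
        fun i => hasZeroMean_conj (Φ.g_zeroMean i), Φ.φ, Φ.φ_contDiff, Φ.φ_compact⟩ :
        CylindricalTest (Fin 3)).grad u (fun i => x (swap 1 2 i))) := by
  unfold CylindricalTest.grad
  rw [coords_th hT Φ u]
  funext x
  simp only [map_sum, LinearIsometryEquiv.map_smul, a_a, Equiv.swap_apply_self]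

/-- **Covariance of stationary statistical solutions under the axis swap.** For every viscosity
`ν`, force `f`, stationary statistical solution `μ` of `NS_ν(f)` on `T³` (FMRT Ch. IV Def. 1.3) and
continuous linear `T` on `H` representing the conjugation a.e., the push-forward of `μ` under `T`
is a stationary statistical solution of `NS_ν(A ∘ f ∘ P)`. No hypothesis on `f`. [folklore] -/
theorem isStationaryStatisticalSolution_map {ν : ℝ} {f : UnitAddTorus (Fin 3) → EuclideanSpace ℝ (Fin 3)}
    {μ : Measure (energySpace (Fin 3))} (hμ : IsStationaryStatisticalSolution ν f μ) :
    IsStationaryStatisticalSolution ν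
      (fun x => piLpCongrLeft 2 ℝ ℝ (swap 1 2) (f (fun i => x (swap 1 2 i)))) (Measure.map T μ) := by
  have hge := measurableEmbedding_th hT
  have hE : ∀ u : energySpace (Fin 3),
      eGradNormSq ((T u).1 : UnitAddTorus (Fin 3) → EuclideanSpace ℝ (Fin 3)) =
        eGradNormSq (u.1 : UnitAddTorus (Fin 3) → EuclideanSpace ℝ (Fin 3)) :=
    fun u => eGradNormSq_of_ae_conj (hT u)
  haveI := hμ.prob
  refine ⟨Measure.isProbabilityMeasure_map hge.measurable.aemeasurable, ?_, ?_, ?_⟩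
  · -- (1.29) finite mean enstrophy
    rw [hge.lintegral_map]
    simp_rw [hE]
    exact hμ.enstrophy_finite
  · -- (1.30) the stationary Liouville equation, tested against the swapped functional
    intro Φ
    set ΦT : CylindricalTest (Fin 3) :=
      ⟨Φ.m, fun i x => piLpCongrLeft 2 ℝ ℝ (swap 1 2) (Φ.g i (fun k => x (swap 1 2 k))),
        fun i => isContDiff_conj (Φ.g_smooth i),
        fun i x => (divergence_conj (Φ.g i) x).trans (Φ.g_divFree i _),
        fun i => hasZeroMean_conj (Φ.g_zeroMean i), Φ.φ, Φ.φ_contDiff, Φ.φ_compact⟩ with hΦT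
    have hgen : ∀ u : energySpace (Fin 3),
        nsGeneratorPairing ν (fun x => piLpCongrLeft 2 ℝ ℝ (swap 1 2) (f (fun i => x (swap 1 2 i))))
          (T u) (Φ.grad (T u)) = nsGeneratorPairing ν f u (ΦT.grad u) := by
      intro u
      rw [grad_th hT Φ u, ← hΦT]
      exact nsGeneratorPairing_th hT ν f u (isSmooth_grad ΦT u)
    obtain ⟨hint, h0⟩ := hμ.generator ΦT
    refine ⟨?_, ?_⟩
    · rw [hge.integrable_map_iff]
      have hcomp : ((fun u : energySpace (Fin 3) => nsGeneratorPairing ν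
          (fun x => piLpCongrLeft 2 ℝ ℝ (swap 1 2) (f (fun i => x (swap 1 2 i)))) u (Φ.grad u)) ∘ T) =
          fun u => nsGeneratorPairing ν f u (ΦT.grad u) := by
        funext u
        exact hgen u
      rw [hcomp]
      exact hint
    · rw [hge.integral_map]
      simp_rw [hgen]
      exact h0
  · -- (1.31) the shell energy inequality: shells are `T`-invariant
    intro e₁ e₂ h12
    rw [hge.setIntegral_map]
    have hset : T ⁻¹' {u : energySpace (Fin 3) | e₁ ≤ ‖u‖ₑ ^ 2 ∧ ‖u‖ₑ ^ 2 < e₂} =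
        {u : energySpace (Fin 3) | e₁ ≤ ‖u‖ₑ ^ 2 ∧ ‖u‖ₑ ^ 2 < e₂} := by
      ext u
      simp only [Set.mem_preimage, Set.mem_setOf_eq, enorm_th hT]
    have hI : ∀ u : energySpace (Fin 3),
        ν * (eGradNormSq ((T u).1 : UnitAddTorus (Fin 3) → EuclideanSpace ℝ (Fin 3))).toReal -
            pairing (T u).1 (fun x => piLpCongrLeft 2 ℝ ℝ (swap 1 2) (f (fun i => x (swap 1 2 i)))) =
          ν * (eGradNormSq (u.1 : UnitAddTorus (Fin 3) → EuclideanSpace ℝ (Fin 3))).toReal -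
            pairing u.1 f := by
      intro u
      rw [hE, pairing_of_ae_conj (hT u)]
      simp only [Equiv.swap_apply_self, a_a]
    rw [hset]
    simp_rw [hI]
    exact hμ.energy_ineq e₁ e₂ h12

end Covariance

/-- The conjugation is an involution on forces. [folklore] -/
theorem conj_conj (f : UnitAddTorus (Fin 3) → EuclideanSpace ℝ (Fin 3)) :
    (fun x : UnitAddTorus (Fin 3) => piLpCongrLeft 2 ℝ ℝ (swap 1 2)
      ((fun y : UnitAddTorus (Fin 3) => piLpCongrLeft 2 ℝ ℝ (swap 1 2) (f (fun i => y (swap 1 2 i))))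
        (fun i => x (swap 1 2 i)))) = f :=
  funext fun x => by simp only [Equiv.swap_apply_self, a_a]

/-- **No-SSS classes correspond under the swap**: `f` carries no stationary statistical solution
of `NS_ν` iff `A ∘ f ∘ P` carries none. [folklore] -/
theorem forall_not_isSSS_iff_conj (ν : ℝ) (f : UnitAddTorus (Fin 3) → EuclideanSpace ℝ (Fin 3)) :
    (∀ μ : Measure (energySpace (Fin 3)), ¬ IsStationaryStatisticalSolution ν f μ) ↔
      ∀ μ : Measure (energySpace (Fin 3)), ¬ IsStationaryStatisticalSolution ν
        (fun x => piLpCongrLeft 2 ℝ ℝ (swap 1 2) (f (fun i => x (swap 1 2 i)))) μ := by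
  obtain ⟨T, hT⟩ := exists_operator
  constructor
  · intro h μ hμ
    have h' := isStationaryStatisticalSolution_map hT hμ
    rw [conj_conj] at h'
    exact h _ h'
  · intro h μ hμ
    exact h _ (isStationaryStatisticalSolution_map hT hμ)

end OrientationBridge

open OrientationBridge in
/-- **`GPOrientationBridge` (stmt-AnomalousDissipation-18404).** The cyclic force
`f₁ = sin(2πx₁)e₀ + sin(2πx₂)e₁ + sin(2πx₀)e₂` of `ForcedSmallScales.CyclicForceCoercive` carries
no stationary statistical solution of the forced Euler equations (FMRT class) iff `f_GP` is
Euler-coercive (`GPEulerCoercive`): the coordinate swap `x₁ ↔ x₂` of `T³`, with components permuted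
accordingly, is a lattice isometry carrying `f_GP` to `f₁` (`OrientationBridge.conj_gpForce`), and
stationary statistical solutions push forward along it (`isStationaryStatisticalSolution_map`,
`forall_not_isSSS_iff_conj`). [folklore] -/
theorem gpOrientationBridge_proof :
    Summit.AnomalousDissipation.AnomalousDissipation.Theses.TameRoughRigidity.GPOrientationBridge := by
  unfold Summit.AnomalousDissipation.AnomalousDissipation.Theses.TameRoughRigidity.GPOrientationBridge
    Summit.AnomalousDissipation.AnomalousDissipation.Theses.TameRoughRigidity.GPEulerCoercive
  have key := forall_not_isSSS_iff_conj 0 (fun x : UnitAddTorus (Fin 3) =>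
    (stokesMode (Pi.single (2 : Fin 3) (1 : ℤ)) (EuclideanSpace.single (0 : Fin 3) (1 : ℝ)) false x +
      stokesMode (Pi.single (0 : Fin 3) (1 : ℤ)) (EuclideanSpace.single (1 : Fin 3) (1 : ℝ)) false x +
      stokesMode (Pi.single (1 : Fin 3) (1 : ℤ)) (EuclideanSpace.single (2 : Fin 3) (1 : ℝ)) false x :
        EuclideanSpace ℝ (Fin 3)))
  rw [conj_gpForce] at key
  rw [← key]
  constructor
  · rintro h f rfl
    exact h
  · intro h
    exact h _ rfl

end Summit.AnomalousDissipation.AnomalousDissipation.Theorems.TameRoughRigidity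

end
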